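import Summits.PneNP.PneNP.Theorems.RamseyUncertifiableResolutionUncertaintyTreeLikeWalk

/-!
# Tree-like refutations of the unary clique CNF enumerate cliques — item stmt-PneNP-9816
# `RamseyUncertifiable.ResolutionUncertainty` (support), the TREE-LIKE rung

`treelike_cliqueCNF_length_ge_card_cliqueFinset`: if `π` is a TREE-LIKE resolution refutation of the unary
`Clique(G, k)` (`cliqueCNF n k (G.Adj)`), then for every `t` the number of lines of `π` is at least the number of
`t`-cliques of `G` (indeed at least the size of any family of cliques: `TreeLike.card_le_length_of_isTreeLike`).

Proof (Prover–Delayer, one Delayer per clique; the walk is in `…TreeLikeWalk.lean`). Fix a clique `Q`. Delayer `Q`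
answers `x_{i,v} = 1` iff `v ∈ Q`, block `i` holds no `1` yet and `v` holds no `1` in any block (`TreeLike.answer`).
The walk from an empty clause ends at an initial clause falsified by the record; the record never falsifies a
functionality or edge axiom (pins are distinct vertices of the clique `Q`, one per block: invariant `TreeLike.DInv`),
so it ends at a block axiom `⋁_v x_{i,v}` all of whose variables are recorded `0` — which forces every `q ∈ Q` to be
pinned in some other block: the pinned vertices of the final record are exactly `Q` (`TreeLike.pins_leaf`). In a
tree-like `π` every line has at most one consumer (`TreeLike.consumer_unique`), so two walks at the same line hold the
same record (`TreeLike.run_snd_eq_of_fst_eq`); hence `Q ↦ final line` is injective on cliques.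
[cf. M. Lauria, *Cliques enumeration and tree-like resolution proofs*, IPL 135 (2018), relating tree-like refutations
of clique formulas to clique enumeration; statement and proof here are self-contained. Tree-like hardness of the
unary clique formula of Ramsey graphs: Lauria–Pudlák–Rödl–Thapen arXiv:1303.3166 Thm 4.]
-/

set_option linter.dupNamespace false

namespace Summit.PneNP.PneNP.Theorems.RamseyUncertifiableResolutionUncertainty

open Literature.Computability.Complexity Literature.Computability.MetaComplexity
open Summit.PneNP.PneNP.Theorems.RegularResolutionRung.Negative (cliqueCNF)

namespace TreeLike

open scoped Classical

/-- Delayer `Q`'s answer to the query of variable `w` at record `ρ`: `1` iff `w = x_{i,v}` with `i < k`, `v ∈ Q`,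
no variable of block `i` recorded `1`, and `v` recorded `1` in no block. -/
noncomputable def answer (n k : ℕ) (Q : Finset (Fin n)) (ρ : ℕ → Option Bool) (w : ℕ) : Bool :=
  decide (∃ i < k, ∃ v : Fin n, w = i * n + (v : ℕ) ∧ v ∈ Q ∧
    (∀ u : Fin n, ρ (i * n + (u : ℕ)) ≠ some true) ∧ (∀ j < k, ρ (j * n + (v : ℕ)) ≠ some true))


/-! ## Tree-likeness: equal lines force equal records -/

section Tree

variable {φ : CNF ℕ} {π : List (ResLine ℕ)} {r : ℕ}

/-- Two answering rules that move a state to the SAME new line produce the same new record. -/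
theorem step_snd_eq_of_fst_eq (htree : IsTreeLike π) (ans₁ ans₂ : (ℕ → Option Bool) → ℕ → Bool)
    (st : ℕ × (ℕ → Option Bool)) (hst : st.1 < π.length)
    (hne : (step π ans₁ st).1 ≠ st.1) (heq : (step π ans₁ st).1 = (step π ans₂ st).1) :
    (step π ans₁ st).2 = (step π ans₂ st).2 := by
  revert hne heq
  unfold step
  rw [dif_pos hst, dif_pos hst]
  rcases hrule : (π[st.1]'hst).rule with _ | ⟨i, j, v⟩ | ⟨i⟩
  · intro hne _
    exact absurd rfl hne
  · intro hne heq
    have hij := premises_ne htree hst hrule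
    simp only [stepRule] at heq ⊢
    have hb : pivotVal ans₁ st.2 v = pivotVal ans₂ st.2 v := by
      cases h1 : pivotVal ans₁ st.2 v <;> cases h2 : pivotVal ans₂ st.2 v <;> simp_all
    rw [hb]
  · intro _ _
    rfl

/-- **Equal lines, equal records.** For two answering rules, whenever the two walks sit at the same line (at any
two times) they hold the same record. -/
theorem run_snd_eq_of_fst_eq (hπ : IsResDerivation φ π) (htree : IsTreeLike π) (hr : r < π.length)
    (ans₁ ans₂ : (ℕ → Option Bool) → ℕ → Bool) :
    ∀ s s', (run π ans₁ r s).1 = (run π ans₂ r s').1 → (run π ans₁ r s).2 = (run π ans₂ r s').2 := by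
  -- strong induction on `s + s'`
  suffices h : ∀ N s s', s + s' ≤ N →
      (run π ans₁ r s).1 = (run π ans₂ r s').1 → (run π ans₁ r s).2 = (run π ans₂ r s').2 from
    fun s s' => h (s + s') s s' le_rfl
  intro N
  induction N with
  | zero =>
    intro s s' hN _
    obtain ⟨rfl, rfl⟩ : s = 0 ∧ s' = 0 := by omega
    rfl
  | succ N ih =>
    intro s s' hN hline
    -- a walk sitting at the root line holds the empty record
    have hroot : ∀ (ans : (ℕ → Option Bool) → ℕ → Bool) (t : ℕ), (run π ans r t).1 = r →
        (run π ans r t).2 = fun _ => none := by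
      intro ans t ht
      have := run_eq_of_fst_eq ans hπ hr 0 t (by simpa [run] using ht.symm)
      rw [Nat.zero_add] at this
      rw [← this]
      rfl
    rcases s with _ | a
    · -- `s = 0`
      have h0 : (run π ans₁ r 0) = (r, fun _ => none) := rfl
      rw [h0] at hline ⊢
      exact (hroot ans₂ s' hline.symm).symm
    rcases s' with _ | a'
    · have h0 : (run π ans₂ r 0) = (r, fun _ => none) := rfl
      rw [h0] at hline ⊢
      exact hroot ans₁ (a + 1) hline
    -- both times are successors
    by_cases hA : (run π ans₁ r a).1 = (run π ans₁ r (a + 1)).1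
    · have := run_eq_of_fst_eq ans₁ hπ hr a 1 hA
      rw [← this] at hline ⊢
      exact ih a (a' + 1) (by omega) hline
    by_cases hB : (run π ans₂ r a').1 = (run π ans₂ r (a' + 1)).1
    · have := run_eq_of_fst_eq ans₂ hπ hr a' 1 hB
      rw [← this] at hline ⊢
      exact ih (a + 1) a' (by omega) hline
    -- both walks moved at their last step: the common new line has a unique consumer
    have hltA := run_fst_lt ans₁ hπ hr a
    have hltB := run_fst_lt ans₂ hπ hr a'
    have hmA : (run π ans₁ r (a + 1)).1 ∈ (π[(run π ans₁ r a).1]'hltA).premises := by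
      rcases step_fst ans₁ hπ (run π ans₁ r a) hltA with h | ⟨h, -⟩
      · exact absurd (congrArg Prod.fst h).symm hA
      · exact h
    have hmB : (run π ans₂ r (a' + 1)).1 ∈ (π[(run π ans₂ r a').1]'hltB).premises := by
      rcases step_fst ans₂ hπ (run π ans₂ r a') hltB with h | ⟨h, -⟩
      · exact absurd (congrArg Prod.fst h).symm hB
      · exact h
    rw [hline] at hmA
    have hp : (run π ans₁ r a).1 = (run π ans₂ r a').1 := consumer_unique htree hltA hltB hmA hmB
    have hrec : (run π ans₁ r a).2 = (run π ans₂ r a').2 := ih a a' (by omega) hp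
    have hst : run π ans₁ r a = run π ans₂ r a' := Prod.ext hp hrec
    show (step π ans₁ (run π ans₁ r a)).2 = (step π ans₂ (run π ans₂ r a')).2
    rw [hst]
    refine step_snd_eq_of_fst_eq htree ans₁ ans₂ _ hltB ?_ ?_
    · rw [← hst]
      exact fun h => hA h.symm
    · have h1 : (step π ans₁ (run π ans₁ r a)).1 = (run π ans₁ r (a + 1)).1 := rfl
      rw [hst] at h1
      rw [h1, hline]
      rfl

end Tree

/-! ## The clique Delayer: invariants of the record and the final line -/

section Delayer

variable {n k : ℕ}

/-- The vertices pinned (recorded `1` in some block `< k`) by a record. -/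
noncomputable def pins (n k : ℕ) (ρ : ℕ → Option Bool) : Finset (Fin n) :=
  Finset.univ.filter fun v => ∃ i < k, ρ (i * n + (v : ℕ)) = some true

/-- Invariant of the records produced by Delayer `Q`: pins are vertices of `Q`, at most one per block, each in at
most one block; and a vertex `q ∈ Q` recorded `0` in block `i` was refused for cause (block `i` or vertex `q` was
already pinned). -/
structure DInv (n k : ℕ) (Q : Finset (Fin n)) (ρ : ℕ → Option Bool) : Prop where
  mem : ∀ i < k, ∀ v : Fin n, ρ (i * n + (v : ℕ)) = some true → v ∈ Q
  block : ∀ i < k, ∀ u v : Fin n, ρ (i * n + (u : ℕ)) = some true → ρ (i * n + (v : ℕ)) = some true → u = v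
  vertex : ∀ i < k, ∀ j < k, ∀ v : Fin n, ρ (i * n + (v : ℕ)) = some true → ρ (j * n + (v : ℕ)) = some true → i = j
  refused : ∀ i < k, ∀ q ∈ Q, ρ (i * n + (q : ℕ)) = some false →
    (∃ u : Fin n, ρ (i * n + (u : ℕ)) = some true) ∨ (∃ j < k, ρ (j * n + (q : ℕ)) = some true)

/-- The empty record satisfies the invariant. -/
theorem dInv_empty (Q : Finset (Fin n)) : DInv n k Q (fun _ => none) :=
  ⟨fun _ _ _ h => by simp at h, fun _ _ _ _ h => by simp at h, fun _ _ _ _ _ h => by simp at h,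
    fun _ _ _ _ h => by simp at h⟩

/-- Recording the Delayer's answer to a fresh query preserves the invariant. -/
theorem dInv_update {Q : Finset (Fin n)} {ρ : ℕ → Option Bool} (h : DInv n k Q ρ) {w : ℕ} (hw : ρ w = none) :
    DInv n k Q (fun x => if x = w then some (answer n k Q ρ w) else ρ x) := by
  -- the new record extends the old one
  have hext : ∀ x b, ρ x = some b → (fun x => if x = w then some (answer n k Q ρ w) else ρ x) x = some b := by
    intro x b hx
    beta_reduce
    rw [if_neg]
    · exact hx
    · rintro rfl; rw [hw] at hx; exact absurd hx (by simp)
  -- reading the new record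
  have hread : ∀ x b, (fun x => if x = w then some (answer n k Q ρ w) else ρ x) x = some b →
      (x = w ∧ answer n k Q ρ w = b) ∨ (x ≠ w ∧ ρ x = some b) := by
    intro x b hx
    beta_reduce at hx
    by_cases hxw : x = w
    · rw [if_pos hxw] at hx
      exact Or.inl ⟨hxw, Option.some.inj hx⟩
    · rw [if_neg hxw] at hx
      exact Or.inr ⟨hxw, hx⟩
  -- what a `true` answer says
  have htrue : answer n k Q ρ w = true → ∃ i < k, ∃ v : Fin n, w = i * n + (v : ℕ) ∧ v ∈ Q ∧
      (∀ u : Fin n, ρ (i * n + (u : ℕ)) ≠ some true) ∧ (∀ j < k, ρ (j * n + (v : ℕ)) ≠ some true) := by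
    intro ha
    simpa [answer] using ha
  refine ⟨?_, ?_, ?_, ?_⟩
  · intro i hi v hv
    rcases hread _ _ hv with ⟨hvw, ha⟩ | ⟨-, hv⟩
    · obtain ⟨i', -, v', hw', hvQ, -, -⟩ := htrue ha
      rw [← hvw] at hw'
      obtain ⟨-, rfl⟩ := blockVar_inj hw'
      exact hvQ
    · exact h.mem i hi v hv
  · intro i hi u v hu hv
    rcases hread _ _ hu with ⟨huw, ha⟩ | ⟨-, hu⟩ <;> rcases hread _ _ hv with ⟨hvw, ha'⟩ | ⟨-, hv⟩
    · exact (blockVar_inj (huw.trans hvw.symm)).2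
    · obtain ⟨i', -, v', hw', -, hblk, -⟩ := htrue ha
      rw [← huw] at hw'
      obtain ⟨rfl, rfl⟩ := blockVar_inj hw'
      exact absurd hv (hblk v)
    · obtain ⟨i', -, v', hw', -, hblk, -⟩ := htrue ha'
      rw [← hvw] at hw'
      obtain ⟨rfl, rfl⟩ := blockVar_inj hw'
      exact absurd hu (hblk u)
    · exact h.block i hi u v hu hv
  · intro i hi j hj v hu hv
    rcases hread _ _ hu with ⟨huw, ha⟩ | ⟨-, hu⟩ <;> rcases hread _ _ hv with ⟨hvw, ha'⟩ | ⟨-, hv⟩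
    · exact (blockVar_inj (huw.trans hvw.symm)).1
    · obtain ⟨i', -, v', hw', -, -, hvx⟩ := htrue ha
      rw [← huw] at hw'
      obtain ⟨rfl, rfl⟩ := blockVar_inj hw'
      exact absurd hv (hvx j hj)
    · obtain ⟨i', -, v', hw', -, -, hvx⟩ := htrue ha'
      rw [← hvw] at hw'
      obtain ⟨rfl, rfl⟩ := blockVar_inj hw'
      exact absurd hu (hvx i hi)
    · exact h.vertex i hi j hj v hu hv
  · intro i hi q hq hf
    rcases hread _ _ hf with ⟨hqw, ha⟩ | ⟨-, hf⟩
    · -- the fresh answer was `false`: one of the two refusal causes holds in the old record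
      have hnot : ¬ ((∀ u : Fin n, ρ (i * n + (u : ℕ)) ≠ some true) ∧ (∀ j < k, ρ (j * n + (q : ℕ)) ≠ some true)) := by
        intro hc
        have : answer n k Q ρ w = true := by
          simp only [answer, decide_eq_true_eq]
          exact ⟨i, hi, q, hqw.symm, hq, hc.1, hc.2⟩
        rw [this] at ha
        exact Bool.noConfusion ha
      rcases not_and_or.1 hnot with h1 | h1
      · push Not at h1
        obtain ⟨u, hu⟩ := h1
        exact Or.inl ⟨u, hext _ _ hu⟩
      · push Not at h1
        obtain ⟨j, hj, hu⟩ := h1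
        exact Or.inr ⟨j, hj, hext _ _ hu⟩
    · rcases h.refused i hi q hq hf with ⟨u, hu⟩ | ⟨j, hj, hu⟩
      · exact Or.inl ⟨u, hext _ _ hu⟩
      · exact Or.inr ⟨j, hj, hext _ _ hu⟩

/-- One step of the walk with Delayer `Q` preserves the invariant. -/
theorem dInv_step {π : List (ResLine ℕ)} {Q : Finset (Fin n)} (st : ℕ × (ℕ → Option Bool))
    (h : DInv n k Q st.2) : DInv n k Q (step π (answer n k Q) st).2 := by
  unfold step
  split_ifs with hlt
  · rcases (π[st.1]'hlt).rule with _ | ⟨i, j, v⟩ | ⟨i⟩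
    · exact h
    · simp only [stepRule]
      rcases hv : st.2 v with _ | b
      · have : pivotVal (answer n k Q) st.2 v = answer n k Q st.2 v := by simp [pivotVal, hv]
        rw [this]
        exact dInv_update h hv
      · have : (fun w => if w = v then some (pivotVal (answer n k Q) st.2 v) else st.2 w) = st.2 := by
          funext w
          by_cases hw : w = v
          · subst hw; simp [pivotVal, hv]
          · rw [if_neg hw]
        rw [this]
        exact h
    · exact h
  · exact h

/-- The invariant holds all along Delayer `Q`'s walk. -/
theorem dInv_run {π : List (ResLine ℕ)} {Q : Finset (Fin n)} {r : ℕ} (s : ℕ) :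
    DInv n k Q (run π (answer n k Q) r s).2 := by
  induction s with
  | zero => exact dInv_empty Q
  | succ s ih => exact dInv_step _ ih

/-- Pins of an invariant record lie in `Q`. -/
theorem pins_subset {Q : Finset (Fin n)} {ρ : ℕ → Option Bool} (h : DInv n k Q ρ) : pins n k ρ ⊆ Q := by
  intro v hv
  simp only [pins, Finset.mem_filter, Finset.mem_univ, true_and] at hv
  obtain ⟨i, hi, hv⟩ := hv
  exact h.mem i hi v hv

/-- **The final line pins exactly `Q`.** If an invariant record falsifies a clause of `Clique(G, k)` and `Q` is a
clique of `G`, then the clause is a block axiom and the pinned vertices are exactly `Q`. -/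
theorem pins_eq_of_falsified (G : SimpleGraph (Fin n)) [DecidableRel G.Adj] {Q : Finset (Fin n)}
    (hQ : G.IsClique (Q : Set (Fin n))) {ρ : ℕ → Option Bool} (h : DInv n k Q ρ) {c : Clause ℕ}
    (hc : c ∈ cliqueCNF n k fun u v => decide (G.Adj u v)) (hf : ∀ l ∈ c.toFinset, ρ l.1 = some (!l.2)) :
    pins n k ρ = Q := by
  rcases cliqueCNF_cases hc with ⟨i, hi, hblk⟩ | ⟨i, hi, u, v, huv, hcl⟩ | ⟨i, hi, j, hj, u, v, hij, hadj, hcl⟩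
  · -- block axiom: every vertex of block `i` recorded `0`
    refine Finset.Subset.antisymm (pins_subset h) fun q hq => ?_
    have h0 : ρ (i * n + (q : ℕ)) = some false := hf _ (hblk q)
    rcases h.refused i hi q hq h0 with ⟨u, hu⟩ | ⟨j, hj, hu⟩
    · have := hf _ (hblk u)
      rw [hu] at this
      exact absurd this (by simp)
    · simp only [pins, Finset.mem_filter, Finset.mem_univ, true_and]
      exact ⟨j, hj, hu⟩
  · -- functionality axiom: two pins in one block
    exfalso
    have hu : ρ (i * n + (u : ℕ)) = some true := hf (i * n + (u : ℕ), false) (by simp [hcl])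
    have hv : ρ (i * n + (v : ℕ)) = some true := hf (i * n + (v : ℕ), false) (by simp [hcl])
    exact huv (h.block i hi u v hu hv)
  · -- edge axiom: two adjacent-by-`Q` pins on a non-edge
    exfalso
    have hu : ρ (i * n + (u : ℕ)) = some true := hf (i * n + (u : ℕ), false) (by simp [hcl])
    have hv : ρ (j * n + (v : ℕ)) = some true := hf (j * n + (v : ℕ), false) (by simp [hcl])
    have huQ := h.mem i hi u hu
    have hvQ := h.mem j hj v hv
    by_cases huv : u = v
    · subst huv
      exact hij (h.vertex i hi j hj u hu hv)
    · have : G.Adj u v := hQ huQ hvQ huv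
      rw [decide_eq_true this] at hadj
      exact Bool.noConfusion hadj

end Delayer

/-! ## The theorem -/

section Main

variable {n k : ℕ} (G : SimpleGraph (Fin n)) [DecidableRel G.Adj] {π : List (ResLine ℕ)}

/-- The line where Delayer `Q`'s walk halts. -/
noncomputable def leaf (n k : ℕ) (π : List (ResLine ℕ)) (r : ℕ) (Q : Finset (Fin n)) : ℕ :=
  (run π (answer n k Q) r π.length).1

/-- The record at the leaf of clique `Q` pins exactly `Q`. -/
theorem pins_leaf (hπ : IsResDerivation (cliqueCNF n k fun u v => decide (G.Adj u v)) π) {r : ℕ}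
    (hr : r < π.length) (hroot : (π[r]'hr).clause = ∅) {Q : Finset (Fin n)} (hQ : G.IsClique (Q : Set (Fin n))) :
    pins n k (run π (answer n k Q) r π.length).2 = Q := by
  have hmem := final_mem (answer n k Q) hπ hr
  obtain ⟨c, hc, hceq⟩ := List.mem_map.1 hmem
  refine pins_eq_of_falsified G hQ (dInv_run _) hc ?_
  rw [hceq]
  exact run_falsifies (answer n k Q) hπ hr hroot π.length

/-- **Tree-like refutations of `Clique(G, k)` are at least as long as any family of cliques of `G` is large**:
the map `Q ↦ leaf Q` is injective on cliques and lands in the lines of `π`. -/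
theorem card_le_length_of_isTreeLike (hπ : IsResRefutation (cliqueCNF n k fun u v => decide (G.Adj u v)) π)
    (htree : IsTreeLike π) (S : Finset (Finset (Fin n))) (hS : ∀ Q ∈ S, G.IsClique (Q : Set (Fin n))) :
    S.card ≤ π.length := by
  obtain ⟨hder, l, hl, hle⟩ := hπ
  obtain ⟨r, hr, rfl⟩ := List.getElem_of_mem hl
  calc S.card ≤ (Finset.range π.length).card := by
        refine Finset.card_le_card_of_injOn (leaf n k π r) (fun Q _ => ?_) ?_
        · exact Finset.mem_coe.2 (Finset.mem_range.2 (run_fst_lt _ hder hr _))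
        · intro Q hQ Q' hQ' hQQ'
          have hrec := run_snd_eq_of_fst_eq hder htree hr (answer n k Q) (answer n k Q') π.length π.length hQQ'
          have h1 := pins_leaf G hder hr hle (hS Q hQ)
          have h2 := pins_leaf G hder hr hle (hS Q' hQ')
          rw [← h1, ← h2, hrec]
    _ = π.length := Finset.card_range _

/-- **Tree-like refutations of `Clique(G, k)` enumerate cliques**: for every `t`, a tree-like resolution refutation of
the unary `Clique(G, k)` has at least as many lines as `G` has `t`-cliques. -/
theorem cliqueFinset_card_le_length_of_isTreeLike
    (hπ : IsResRefutation (cliqueCNF n k fun u v => decide (G.Adj u v)) π) (htree : IsTreeLike π) (t : ℕ) :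
    (G.cliqueFinset t).card ≤ π.length :=
  card_le_length_of_isTreeLike G hπ htree _ fun _ hQ => (SimpleGraph.mem_cliqueFinset_iff.1 hQ).isClique

end Main

end TreeLike

/-- **Tree-like refutations of `Clique(G, k)` enumerate cliques.** For every graph `G` on `Fin n`, every `k`, every
tree-like resolution refutation `π` of the unary `Clique(G, k)` and every `t`, the number of `t`-cliques of `G` is at
most the number of lines of `π`. In particular tree-like refutations of `Clique(G, k)` on graphs with `n^{Ω(log n)}`
cliques — e.g. 2-Ramsey graphs, through their Prömel–Rödl core — have length `n^{Ω(log n)}`. -/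
theorem treelike_cliqueCNF_length_ge_card_cliqueFinset :
    ∀ {n k : ℕ} (G : SimpleGraph (Fin n)) [DecidableRel G.Adj] (π : List (ResLine ℕ)) (t : ℕ),
      IsResRefutation (cliqueCNF n k fun u v => decide (G.Adj u v)) π → IsTreeLike π →
        (G.cliqueFinset t).card ≤ π.length := by
  intro n k G _ π t hπ htree
  exact TreeLike.cliqueFinset_card_le_length_of_isTreeLike G hπ htree t

end Summit.PneNP.PneNP.Theorems.RamseyUncertifiableResolutionUncertainty
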